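import Summits.QuantumFields.YangMills.Theorems.FluctuationComparisonRegPrIntLOrganTangentFibreMeanTransport
import Summits.QuantumFields.YangMills.Theorems.FluctuationComparisonRegPrIntLOrganTangentFibreMeanSquareKnit
import HarnessLib

/-!
# Crux `FluctuationComparisonRegPrIntL` (stmt-QuantumFields-20520, rung R3), PATH-B organ, v18 (H-currency) — (L21c) BRICK 2b DOCKED ON THE `σ`-FRAME:
# the second difference of the `σ`-fibre mean along two COVERED coarse moves = BRICK 2b's four channels over the reference fibre law `σ_{U₀}`, a.e.

Cell `ym3-torus` (YM ladder rung R3 = continuum `SU(2)` Yang–Mills on the three-torus — a RUNG: NOT d = 4, NOT infinite volume, NOT a mass gap, NOT Clay).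
Width seat `ym-ust-20520-w5` (gen 23), `--supports stmt-QuantumFields-20520 --as helper`, count-neutral, no registry ∕ binder ∕ `Lines/` edit, DEFINITION-FREE,
default heartbeats.  Over (L21a) ✓`…OrganTangentDisintegrationTransport`, (L21b) ✓`…OrganTangentFibreMeanTransport` and BRICK 2b ✓p807533
`…OrganTangentFibreMeanSquareKnit` (LEAD w3 g25).

WHAT THIS IS.  Generic data: `m` finite on standard-Borel `Y`, `d : Y → X`, a Markov disintegration `σ` (`bind` + fibre clause — LINᵘ-H's σ-binder), TWO coarse
moves `g₁ g₂ : X ≃ᵐ X` with fine transports `τ₁ τ₂` covering them and change-of-variables letters `r₁ r₂ > 0`; a bounded measurable integrand `h` (`|h| ≤ M`) and a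
bounded non-negative measurable weight `b` (in the frame `b = χ·ρ′`, `h = log ρ − log ρ′`).  The `σ`-FIBRE MEAN `𝔪(V) := (∫ h·b ∂σ V) ∕ (∫ b ∂σ V)`.  Then for
`(m.map d)`-a.e. reference corner `U₀` whose four corner masses `∫ b ∂σ(·)` at `U₀, g₁U₀, g₂U₀, g₂(g₁U₀)` are non-zero:
★★★`ae_fibreMean_secondDiff_eq_transport` — `𝔪(g₂(g₁U₀)) − 𝔪(g₁U₀) − 𝔪(g₂U₀) + 𝔪(U₀)` EQUALS BRICK 2b's right-hand side ✓`fibreMean_secondDiff_eq` on the ONE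
fibre `(Ω, P) := (Y, σ U₀)` with `F₀₀ = h`, `F₁₀ = h∘τ₁`, `F₀₁ = h∘τ₂`, `F₁₁ = h∘τ₂∘τ₁` and the NORMALISED weights `ŵ₀₀ ∝ b`, `ŵ₁₀ ∝ r₁·(b∘τ₁)`,
`ŵ₀₁ ∝ r₂·(b∘τ₂)`, `ŵ₁₁ ∝ r₁·(r₂∘τ₁)·(b∘τ₂∘τ₁)` (any centring constants `c₁ c₂ c₀`); ★★`ae_abs_fibreMean_secondDiff_le_transport` — its four-channel reading
✓`abs_fibreMean_secondDiff_le` (`|ΔΔ𝔪| ≤ A + B₁∫|ŵ₁₁−ŵ₁₀| + B₂∫|ŵ₁₁−ŵ₀₁| + B₀∫|ΔΔŵ|` from the sup letters `A B₁ B₂ B₀` of the pulled-back `h`).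
Mechanism: (L21b) ★★★`ae_fibreMean_transport` three times — at `(g₁, τ₁, r₁)`, at `(g₂, τ₂, r₂)`, and at the COMPOSITE `(g₁.trans g₂, τ₂∘τ₁, r₁·(r₂∘τ₁))`
((L21a) ★`cv_comp`∕`cov_comp`) — all at the same reference corner, plus the integrability of the letters under `σ U₀` ((L21a) ★`ae_lintegral_kernel_lt_top`).

HONEST FRAMING: measure-theoretic plumbing; NO transport ∕ letter ∕ weight is constructed for the runs' towers (HYPOTHESES of SPREAD-TRANSPORT-H ∕ FIBRE-LAW-H);
the letters `A B₁ B₂ B₀` and the weight-variation integrals are NOT estimated (BRICK 2a ∕ 3 ∕ FIBRE-LAW-H); nothing of Bałaban's analysis is asserted or proved;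
LINᵘ-H ∕ JVARᵘ-H ∕ O1ᵘ-H v2 ∕ S1aᴴ ∕ 26243 ∕ S2α′ ∕ S2β OPEN; crux 20520 `FluctuationComparisonRegPrIntL` ∕ `YM3TorusSU2` NOT proved; no summit ∕ sub-problem statement
is proved; registry untouched; rung R3 = SU(2) YM₃ on T³ at fixed lattice data — NOT d = 4, NOT infinite volume, NOT a mass gap, NOT Clay; the Yang–Mills mass gap
is NOT proved.  [folklore] measure theory.
-/

set_option autoImplicit false

noncomputable section

namespace Summit.QuantumFields.YangMills.Theorems.OrganTangentFibreMeanSquareTransport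

open MeasureTheory ProbabilityTheory Filter Topology Set
open scoped ENNReal
open Summit.QuantumFields.YangMills.Theorems.OrganTangentDisintegrationTransport
open Summit.QuantumFields.YangMills.Theorems.OrganTangentFibreMeanTransport
open Summit.QuantumFields.YangMills.Theorems.OrganTangentFibreMeanSquareKnit

variable {X Y : Type*} [MeasurableSpace X] [MeasurableSpace Y]

/-- A non-negative measurable real letter with finite `lintegral` is integrable. [folklore] -/
theorem integrable_of_lintegral_lt_top (μ : Measure Y) {r : Y → ℝ} (hr : Measurable r) (hr0 : ∀ U, 0 ≤ r U)
    (h : ∫⁻ U, ENNReal.ofReal (r U) ∂μ < ∞) : Integrable r μ :=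
  ⟨hr.aestronglyMeasurable, (hasFiniteIntegral_iff_ofReal (Eventually.of_forall hr0)).mpr h⟩

/-- A bounded measurable factor times an integrable letter is integrable (argument order of this file). [folklore] -/
theorem integrable_mul_bdd (μ : Measure Y) {r c : Y → ℝ} (hr : Integrable r μ) (hc : Measurable c) {M : ℝ} (hcb : ∀ U, |c U| ≤ M) :
    Integrable (fun U => r U * c U) μ := by
  refine hr.mul_bdd (c := M) hc.aestronglyMeasurable (Eventually.of_forall fun U => ?_)
  rw [Real.norm_eq_abs]; exact hcb U

/-- The trivial corner: `(∫ h·b) ∕ (∫ b) = ∫ h·(b ∕ ∫ b)` and `∫ b ∕ ∫ b = 1` (`∫ b ≠ 0`). [folklore] -/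
theorem fibreMean_eq_integral_normalised (P : Measure Y) (h b : Y → ℝ) (hD : ∫ U, b U ∂P ≠ 0) :
    (∫ U, h U * b U ∂P) / (∫ U, b U ∂P) = ∫ U, h U * (b U / ∫ U', b U' ∂P) ∂P ∧ ∫ U, b U / (∫ U', b U' ∂P) ∂P = 1 := by
  refine ⟨?_, ?_⟩
  · rw [← integral_div]
    refine integral_congr_ae (Eventually.of_forall fun U => ?_)
    simp only
    ring
  · rw [integral_div, div_self hD]

/-- ★★★ **BRICK 2b DOCKED ON THE `σ`-FRAME — EXACT EDITION** (see the module docstring). [folklore] -/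
theorem ae_fibreMean_secondDiff_eq_transport [StandardBorelSpace Y] [Nonempty Y] [MeasurableSingletonClass X]
    (m : Measure Y) [IsFiniteMeasure m] {d : Y → X} (hd : Measurable d)
    (σ : Kernel X Y) [IsMarkovKernel σ]
    (hbind : (m.map d).bind ⇑σ = m) (hfib : ∀ᵐ V ∂(m.map d), ∀ᵐ U ∂(σ V), d U = V)
    (g₁ g₂ : X ≃ᵐ X) {τ₁ τ₂ : Y → Y} (hτ₁ : Measurable τ₁) (hτ₂ : Measurable τ₂)
    (hcov₁ : ∀ U, d (τ₁ U) = g₁ (d U)) (hcov₂ : ∀ U, d (τ₂ U) = g₂ (d U))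
    {r₁ r₂ : Y → ℝ} (hr₁ : Measurable r₁) (hr₂ : Measurable r₂) (hr₁pos : ∀ U, 0 < r₁ U) (hr₂pos : ∀ U, 0 < r₂ U)
    (hcv₁ : (m.withDensity (fun U => ENNReal.ofReal (r₁ U))).map τ₁ = m)
    (hcv₂ : (m.withDensity (fun U => ENNReal.ofReal (r₂ U))).map τ₂ = m)
    {h b : Y → ℝ} (hh : Measurable h) (hb : Measurable b) {M Mb : ℝ} (hhM : ∀ U, |h U| ≤ M) (hbM : ∀ U, |b U| ≤ Mb)
    (c₁ c₂ c₀ : ℝ) :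
    ∀ᵐ U₀ ∂(m.map d),
      (∫ U, b U ∂(σ U₀)) ≠ 0 → (∫ U, b U ∂(σ (g₁ U₀))) ≠ 0 → (∫ U, b U ∂(σ (g₂ U₀))) ≠ 0 → (∫ U, b U ∂(σ (g₂ (g₁ U₀)))) ≠ 0 →
      (∫ U, h U * b U ∂(σ (g₂ (g₁ U₀)))) / (∫ U, b U ∂(σ (g₂ (g₁ U₀))))
        - (∫ U, h U * b U ∂(σ (g₁ U₀))) / (∫ U, b U ∂(σ (g₁ U₀)))
        - (∫ U, h U * b U ∂(σ (g₂ U₀))) / (∫ U, b U ∂(σ (g₂ U₀)))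
        + (∫ U, h U * b U ∂(σ U₀)) / (∫ U, b U ∂(σ U₀))
      = (∫ U, (h (τ₂ (τ₁ U)) - h (τ₁ U) - h (τ₂ U) + h U)
            * (r₁ U * r₂ (τ₁ U) * b (τ₂ (τ₁ U)) / ∫ U', r₁ U' * r₂ (τ₁ U') * b (τ₂ (τ₁ U')) ∂(σ U₀)) ∂(σ U₀))
        + (∫ U, (h (τ₁ U) - h U - c₁)
            * (r₁ U * r₂ (τ₁ U) * b (τ₂ (τ₁ U)) / (∫ U', r₁ U' * r₂ (τ₁ U') * b (τ₂ (τ₁ U')) ∂(σ U₀))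
              - r₁ U * b (τ₁ U) / (∫ U', r₁ U' * b (τ₁ U') ∂(σ U₀))) ∂(σ U₀))
        + (∫ U, (h (τ₂ U) - h U - c₂)
            * (r₁ U * r₂ (τ₁ U) * b (τ₂ (τ₁ U)) / (∫ U', r₁ U' * r₂ (τ₁ U') * b (τ₂ (τ₁ U')) ∂(σ U₀))
              - r₂ U * b (τ₂ U) / (∫ U', r₂ U' * b (τ₂ U') ∂(σ U₀))) ∂(σ U₀))
        + (∫ U, (h U - c₀)
            * (r₁ U * r₂ (τ₁ U) * b (τ₂ (τ₁ U)) / (∫ U', r₁ U' * r₂ (τ₁ U') * b (τ₂ (τ₁ U')) ∂(σ U₀))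
              - r₁ U * b (τ₁ U) / (∫ U', r₁ U' * b (τ₁ U') ∂(σ U₀))
              - r₂ U * b (τ₂ U) / (∫ U', r₂ U' * b (τ₂ U') ∂(σ U₀))
              + b U / (∫ U', b U' ∂(σ U₀))) ∂(σ U₀)) := by
  -- the composite letters
  have hr₁0 : ∀ U, 0 ≤ r₁ U := fun U => (hr₁pos U).le
  have hr₁₂ : Measurable fun U => r₁ U * r₂ (τ₁ U) := hr₁.mul (hr₂.comp hτ₁)
  have hr₁₂pos : ∀ U, 0 < r₁ U * r₂ (τ₁ U) := fun U => mul_pos (hr₁pos U) (hr₂pos _)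
  have hcov₁₂ := cov_comp g₁ g₂ hcov₁ hcov₂
  have hcv₁₂ := cv_comp_real m hτ₁ hτ₂ hr₁ hr₂ hr₁0 hcv₁ hcv₂
  -- the three transport identities and the three finiteness facts, all at the reference corner
  have T₁ := ae_fibreMean_transport m hd σ hbind hfib g₁ hτ₁ hcov₁ hr₁ hr₁pos hcv₁
  have T₂ := ae_fibreMean_transport m hd σ hbind hfib g₂ hτ₂ hcov₂ hr₂ hr₂pos hcv₂
  have T₁₂ := ae_fibreMean_transport m hd σ hbind hfib (g₁.trans g₂) (hτ₂.comp hτ₁) hcov₁₂ hr₁₂ hr₁₂pos hcv₁₂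
  have I₁ := ae_integral_transport m hd σ hbind hfib g₁ hτ₁ hcov₁ hr₁ hr₁pos hcv₁
  have I₂ := ae_integral_transport m hd σ hbind hfib g₂ hτ₂ hcov₂ hr₂ hr₂pos hcv₂
  have I₁₂ := ae_integral_transport m hd σ hbind hfib (g₁.trans g₂) (hτ₂.comp hτ₁) hcov₁₂ hr₁₂ hr₁₂pos hcv₁₂
  filter_upwards [T₁, T₂, T₁₂, I₁, I₂, I₁₂] with U₀ hT₁ hT₂ hT₁₂ hI₁ hI₂ hI₁₂
  intro hD₀₀ hD₁₀ hD₀₁ hD₁₁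
  -- the displaced denominators, transported
  have hE₁₀ : (∫ U, r₁ U * b (τ₁ U) ∂(σ U₀)) ≠ 0 := by
    intro h0
    apply hD₁₀
    rw [hI₁.2 b hb, h0, zero_div]
  have hE₀₁ : (∫ U, r₂ U * b (τ₂ U) ∂(σ U₀)) ≠ 0 := by
    intro h0
    apply hD₀₁
    rw [hI₂.2 b hb, h0, zero_div]
  have hE₁₁ : (∫ U, r₁ U * r₂ (τ₁ U) * b (τ₂ (τ₁ U)) ∂(σ U₀)) ≠ 0 := by
    intro h0
    apply hD₁₁
    have h := hI₁₂.2 b hb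
    rw [MeasurableEquiv.trans_apply] at h
    rw [h]
    simp only [Function.comp_apply]
    rw [h0, zero_div]
  -- the four corner representations
  obtain ⟨e₁₀, n₁₀⟩ := hT₁ h b hh hb hE₁₀
  obtain ⟨e₀₁, n₀₁⟩ := hT₂ h b hh hb hE₀₁
  have hT := hT₁₂ h b hh hb (by simpa only [Function.comp_apply] using hE₁₁)
  simp only [MeasurableEquiv.trans_apply, Function.comp_apply] at hT
  obtain ⟨e₁₁, n₁₁⟩ := hT
  obtain ⟨e₀₀, n₀₀⟩ := fibreMean_eq_integral_normalised (σ U₀) h b hD₀₀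
  rw [e₁₁, e₁₀, e₀₁, e₀₀]
  -- integrability of the weights (the letters have finite `σ U₀`-mass)
  have hbM' : 0 ≤ Mb := le_trans (abs_nonneg _) (hbM (Classical.arbitrary Y))
  have ir₁ : Integrable r₁ (σ U₀) := by
    refine integrable_of_lintegral_lt_top _ hr₁ hr₁0 ?_
    have := hI₁.1
    rw [integral_eq_toReal_lintegral _ hr₁ hr₁0] at this
    exact lt_top_iff_ne_top.mpr (fun htop => by rw [htop, ENNReal.toReal_top] at this; exact lt_irrefl _ this)
  have ir₂ : Integrable r₂ (σ U₀) := by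
    refine integrable_of_lintegral_lt_top _ hr₂ (fun U => (hr₂pos U).le) ?_
    have := hI₂.1
    rw [integral_eq_toReal_lintegral _ hr₂ (fun U => (hr₂pos U).le)] at this
    exact lt_top_iff_ne_top.mpr (fun htop => by rw [htop, ENNReal.toReal_top] at this; exact lt_irrefl _ this)
  have ir₁₂ : Integrable (fun U => r₁ U * r₂ (τ₁ U)) (σ U₀) := by
    refine integrable_of_lintegral_lt_top _ hr₁₂ (fun U => (hr₁₂pos U).le) ?_
    have := hI₁₂.1
    rw [integral_eq_toReal_lintegral _ hr₁₂ (fun U => (hr₁₂pos U).le)] at this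
    exact lt_top_iff_ne_top.mpr (fun htop => by rw [htop, ENNReal.toReal_top] at this; exact lt_irrefl _ this)
  have iw₀₀ : Integrable (fun U => b U / ∫ U', b U' ∂(σ U₀)) (σ U₀) := by
    have ib : Integrable b (σ U₀) := by
      refine (integrable_const Mb).mono' hb.aestronglyMeasurable (Eventually.of_forall fun U => ?_)
      rw [Real.norm_eq_abs]; exact hbM U
    exact ib.div_const _
  have iw₁₀ : Integrable (fun U => r₁ U * b (τ₁ U) / ∫ U', r₁ U' * b (τ₁ U') ∂(σ U₀)) (σ U₀) :=
    (integrable_mul_bdd _ ir₁ (hb.comp hτ₁) (fun U => hbM _)).div_const _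
  have iw₀₁ : Integrable (fun U => r₂ U * b (τ₂ U) / ∫ U', r₂ U' * b (τ₂ U') ∂(σ U₀)) (σ U₀) :=
    (integrable_mul_bdd _ ir₂ (hb.comp hτ₂) (fun U => hbM _)).div_const _
  have iw₁₁ : Integrable (fun U => r₁ U * r₂ (τ₁ U) * b (τ₂ (τ₁ U)) / ∫ U', r₁ U' * r₂ (τ₁ U') * b (τ₂ (τ₁ U')) ∂(σ U₀)) (σ U₀) :=
    (integrable_mul_bdd _ ir₁₂ (hb.comp (hτ₂.comp hτ₁)) (fun U => hbM _)).div_const _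
  exact fibreMean_secondDiff_eq (σ U₀) h (fun U => h (τ₁ U)) (fun U => h (τ₂ U)) (fun U => h (τ₂ (τ₁ U)))
    (fun U => b U / ∫ U', b U' ∂(σ U₀)) (fun U => r₁ U * b (τ₁ U) / ∫ U', r₁ U' * b (τ₁ U') ∂(σ U₀))
    (fun U => r₂ U * b (τ₂ U) / ∫ U', r₂ U' * b (τ₂ U') ∂(σ U₀))
    (fun U => r₁ U * r₂ (τ₁ U) * b (τ₂ (τ₁ U)) / ∫ U', r₁ U' * r₂ (τ₁ U') * b (τ₂ (τ₁ U')) ∂(σ U₀))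
    M c₁ c₂ c₀ hh.aestronglyMeasurable (hh.comp hτ₁).aestronglyMeasurable (hh.comp hτ₂).aestronglyMeasurable
    (hh.comp (hτ₂.comp hτ₁)).aestronglyMeasurable hhM (fun U => hhM _) (fun U => hhM _) (fun U => hhM _)
    iw₀₀ iw₁₀ iw₀₁ iw₁₁ n₀₀ n₁₀ n₀₁ n₁₁

/-- ★★ **BRICK 2b DOCKED ON THE `σ`-FRAME — FOUR-CHANNEL READING** (✓`abs_fibreMean_secondDiff_le`: sup letters `A` (pulled-back second difference of `h`),
`B₁ B₂` (centred first differences), `B₀` (centred `h`), weight `b ≥ 0`; see the module docstring). [folklore] -/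
theorem ae_abs_fibreMean_secondDiff_le_transport [StandardBorelSpace Y] [Nonempty Y] [MeasurableSingletonClass X]
    (m : Measure Y) [IsFiniteMeasure m] {d : Y → X} (hd : Measurable d)
    (σ : Kernel X Y) [IsMarkovKernel σ]
    (hbind : (m.map d).bind ⇑σ = m) (hfib : ∀ᵐ V ∂(m.map d), ∀ᵐ U ∂(σ V), d U = V)
    (g₁ g₂ : X ≃ᵐ X) {τ₁ τ₂ : Y → Y} (hτ₁ : Measurable τ₁) (hτ₂ : Measurable τ₂)
    (hcov₁ : ∀ U, d (τ₁ U) = g₁ (d U)) (hcov₂ : ∀ U, d (τ₂ U) = g₂ (d U))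
    {r₁ r₂ : Y → ℝ} (hr₁ : Measurable r₁) (hr₂ : Measurable r₂) (hr₁pos : ∀ U, 0 < r₁ U) (hr₂pos : ∀ U, 0 < r₂ U)
    (hcv₁ : (m.withDensity (fun U => ENNReal.ofReal (r₁ U))).map τ₁ = m)
    (hcv₂ : (m.withDensity (fun U => ENNReal.ofReal (r₂ U))).map τ₂ = m)
    {h b : Y → ℝ} (hh : Measurable h) (hb : Measurable b) {M Mb : ℝ} (hhM : ∀ U, |h U| ≤ M) (hbM : ∀ U, |b U| ≤ Mb) (hb0 : ∀ U, 0 ≤ b U)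
    (c₁ c₂ c₀ A B₁ B₂ B₀ : ℝ)
    (hA : ∀ U, |h (τ₂ (τ₁ U)) - h (τ₁ U) - h (τ₂ U) + h U| ≤ A) (hB₁ : ∀ U, |h (τ₁ U) - h U - c₁| ≤ B₁)
    (hB₂ : ∀ U, |h (τ₂ U) - h U - c₂| ≤ B₂) (hB₀ : ∀ U, |h U - c₀| ≤ B₀) :
    ∀ᵐ U₀ ∂(m.map d),
      (∫ U, b U ∂(σ U₀)) ≠ 0 → (∫ U, b U ∂(σ (g₁ U₀))) ≠ 0 → (∫ U, b U ∂(σ (g₂ U₀))) ≠ 0 → (∫ U, b U ∂(σ (g₂ (g₁ U₀)))) ≠ 0 →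
      |(∫ U, h U * b U ∂(σ (g₂ (g₁ U₀)))) / (∫ U, b U ∂(σ (g₂ (g₁ U₀))))
        - (∫ U, h U * b U ∂(σ (g₁ U₀))) / (∫ U, b U ∂(σ (g₁ U₀)))
        - (∫ U, h U * b U ∂(σ (g₂ U₀))) / (∫ U, b U ∂(σ (g₂ U₀)))
        + (∫ U, h U * b U ∂(σ U₀)) / (∫ U, b U ∂(σ U₀))|
      ≤ A + B₁ * (∫ U, |r₁ U * r₂ (τ₁ U) * b (τ₂ (τ₁ U)) / (∫ U', r₁ U' * r₂ (τ₁ U') * b (τ₂ (τ₁ U')) ∂(σ U₀))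
                        - r₁ U * b (τ₁ U) / (∫ U', r₁ U' * b (τ₁ U') ∂(σ U₀))| ∂(σ U₀))
          + B₂ * (∫ U, |r₁ U * r₂ (τ₁ U) * b (τ₂ (τ₁ U)) / (∫ U', r₁ U' * r₂ (τ₁ U') * b (τ₂ (τ₁ U')) ∂(σ U₀))
                        - r₂ U * b (τ₂ U) / (∫ U', r₂ U' * b (τ₂ U') ∂(σ U₀))| ∂(σ U₀))
          + B₀ * (∫ U, |r₁ U * r₂ (τ₁ U) * b (τ₂ (τ₁ U)) / (∫ U', r₁ U' * r₂ (τ₁ U') * b (τ₂ (τ₁ U')) ∂(σ U₀))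
                        - r₁ U * b (τ₁ U) / (∫ U', r₁ U' * b (τ₁ U') ∂(σ U₀))
                        - r₂ U * b (τ₂ U) / (∫ U', r₂ U' * b (τ₂ U') ∂(σ U₀))
                        + b U / (∫ U', b U' ∂(σ U₀))| ∂(σ U₀)) := by
  -- the composite letters
  have hr₁0 : ∀ U, 0 ≤ r₁ U := fun U => (hr₁pos U).le
  have hr₁₂ : Measurable fun U => r₁ U * r₂ (τ₁ U) := hr₁.mul (hr₂.comp hτ₁)
  have hr₁₂pos : ∀ U, 0 < r₁ U * r₂ (τ₁ U) := fun U => mul_pos (hr₁pos U) (hr₂pos _)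
  have hcov₁₂ := cov_comp g₁ g₂ hcov₁ hcov₂
  have hcv₁₂ := cv_comp_real m hτ₁ hτ₂ hr₁ hr₂ hr₁0 hcv₁ hcv₂
  -- the three transport identities and the three finiteness facts, all at the reference corner
  have T₁ := ae_fibreMean_transport m hd σ hbind hfib g₁ hτ₁ hcov₁ hr₁ hr₁pos hcv₁
  have T₂ := ae_fibreMean_transport m hd σ hbind hfib g₂ hτ₂ hcov₂ hr₂ hr₂pos hcv₂
  have T₁₂ := ae_fibreMean_transport m hd σ hbind hfib (g₁.trans g₂) (hτ₂.comp hτ₁) hcov₁₂ hr₁₂ hr₁₂pos hcv₁₂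
  have I₁ := ae_integral_transport m hd σ hbind hfib g₁ hτ₁ hcov₁ hr₁ hr₁pos hcv₁
  have I₂ := ae_integral_transport m hd σ hbind hfib g₂ hτ₂ hcov₂ hr₂ hr₂pos hcv₂
  have I₁₂ := ae_integral_transport m hd σ hbind hfib (g₁.trans g₂) (hτ₂.comp hτ₁) hcov₁₂ hr₁₂ hr₁₂pos hcv₁₂
  filter_upwards [T₁, T₂, T₁₂, I₁, I₂, I₁₂] with U₀ hT₁ hT₂ hT₁₂ hI₁ hI₂ hI₁₂
  intro hD₀₀ hD₁₀ hD₀₁ hD₁₁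
  -- the displaced denominators, transported
  have hE₁₀ : (∫ U, r₁ U * b (τ₁ U) ∂(σ U₀)) ≠ 0 := by
    intro h0
    apply hD₁₀
    rw [hI₁.2 b hb, h0, zero_div]
  have hE₀₁ : (∫ U, r₂ U * b (τ₂ U) ∂(σ U₀)) ≠ 0 := by
    intro h0
    apply hD₀₁
    rw [hI₂.2 b hb, h0, zero_div]
  have hE₁₁ : (∫ U, r₁ U * r₂ (τ₁ U) * b (τ₂ (τ₁ U)) ∂(σ U₀)) ≠ 0 := by
    intro h0
    apply hD₁₁
    have h := hI₁₂.2 b hb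
    rw [MeasurableEquiv.trans_apply] at h
    rw [h]
    simp only [Function.comp_apply]
    rw [h0, zero_div]
  -- the four corner representations
  obtain ⟨e₁₀, n₁₀⟩ := hT₁ h b hh hb hE₁₀
  obtain ⟨e₀₁, n₀₁⟩ := hT₂ h b hh hb hE₀₁
  have hT := hT₁₂ h b hh hb (by simpa only [Function.comp_apply] using hE₁₁)
  simp only [MeasurableEquiv.trans_apply, Function.comp_apply] at hT
  obtain ⟨e₁₁, n₁₁⟩ := hT
  obtain ⟨e₀₀, n₀₀⟩ := fibreMean_eq_integral_normalised (σ U₀) h b hD₀₀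
  rw [e₁₁, e₁₀, e₀₁, e₀₀]
  -- integrability of the weights (the letters have finite `σ U₀`-mass)
  have hbM' : 0 ≤ Mb := le_trans (abs_nonneg _) (hbM (Classical.arbitrary Y))
  have ir₁ : Integrable r₁ (σ U₀) := by
    refine integrable_of_lintegral_lt_top _ hr₁ hr₁0 ?_
    have := hI₁.1
    rw [integral_eq_toReal_lintegral _ hr₁ hr₁0] at this
    exact lt_top_iff_ne_top.mpr (fun htop => by rw [htop, ENNReal.toReal_top] at this; exact lt_irrefl _ this)
  have ir₂ : Integrable r₂ (σ U₀) := by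
    refine integrable_of_lintegral_lt_top _ hr₂ (fun U => (hr₂pos U).le) ?_
    have := hI₂.1
    rw [integral_eq_toReal_lintegral _ hr₂ (fun U => (hr₂pos U).le)] at this
    exact lt_top_iff_ne_top.mpr (fun htop => by rw [htop, ENNReal.toReal_top] at this; exact lt_irrefl _ this)
  have ir₁₂ : Integrable (fun U => r₁ U * r₂ (τ₁ U)) (σ U₀) := by
    refine integrable_of_lintegral_lt_top _ hr₁₂ (fun U => (hr₁₂pos U).le) ?_
    have := hI₁₂.1
    rw [integral_eq_toReal_lintegral _ hr₁₂ (fun U => (hr₁₂pos U).le)] at this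
    exact lt_top_iff_ne_top.mpr (fun htop => by rw [htop, ENNReal.toReal_top] at this; exact lt_irrefl _ this)
  have iw₀₀ : Integrable (fun U => b U / ∫ U', b U' ∂(σ U₀)) (σ U₀) := by
    have ib : Integrable b (σ U₀) := by
      refine (integrable_const Mb).mono' hb.aestronglyMeasurable (Eventually.of_forall fun U => ?_)
      rw [Real.norm_eq_abs]; exact hbM U
    exact ib.div_const _
  have iw₁₀ : Integrable (fun U => r₁ U * b (τ₁ U) / ∫ U', r₁ U' * b (τ₁ U') ∂(σ U₀)) (σ U₀) :=
    (integrable_mul_bdd _ ir₁ (hb.comp hτ₁) (fun U => hbM _)).div_const _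
  have iw₀₁ : Integrable (fun U => r₂ U * b (τ₂ U) / ∫ U', r₂ U' * b (τ₂ U') ∂(σ U₀)) (σ U₀) :=
    (integrable_mul_bdd _ ir₂ (hb.comp hτ₂) (fun U => hbM _)).div_const _
  have iw₁₁ : Integrable (fun U => r₁ U * r₂ (τ₁ U) * b (τ₂ (τ₁ U)) / ∫ U', r₁ U' * r₂ (τ₁ U') * b (τ₂ (τ₁ U')) ∂(σ U₀)) (σ U₀) :=
    (integrable_mul_bdd _ ir₁₂ (hb.comp (hτ₂.comp hτ₁)) (fun U => hbM _)).div_const _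
  -- the diagonal weight is non-negative (its normalisation is positive: non-negative integrand, non-zero integral)
  have hD₁₁pos : 0 < ∫ U', r₁ U' * r₂ (τ₁ U') * b (τ₂ (τ₁ U')) ∂(σ U₀) :=
    lt_of_le_of_ne (integral_nonneg fun U => mul_nonneg (hr₁₂pos U).le (hb0 _)) (Ne.symm hE₁₁)
  have hpos : ∀ U, 0 ≤ r₁ U * r₂ (τ₁ U) * b (τ₂ (τ₁ U)) / ∫ U', r₁ U' * r₂ (τ₁ U') * b (τ₂ (τ₁ U')) ∂(σ U₀) :=
    fun U => div_nonneg (mul_nonneg (hr₁₂pos U).le (hb0 _)) hD₁₁pos.le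
  exact abs_fibreMean_secondDiff_le (σ U₀) h (fun U => h (τ₁ U)) (fun U => h (τ₂ U)) (fun U => h (τ₂ (τ₁ U)))
    (fun U => b U / ∫ U', b U' ∂(σ U₀)) (fun U => r₁ U * b (τ₁ U) / ∫ U', r₁ U' * b (τ₁ U') ∂(σ U₀))
    (fun U => r₂ U * b (τ₂ U) / ∫ U', r₂ U' * b (τ₂ U') ∂(σ U₀))
    (fun U => r₁ U * r₂ (τ₁ U) * b (τ₂ (τ₁ U)) / ∫ U', r₁ U' * r₂ (τ₁ U') * b (τ₂ (τ₁ U')) ∂(σ U₀))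
    M c₁ c₂ c₀ A B₁ B₂ B₀ hh.aestronglyMeasurable (hh.comp hτ₁).aestronglyMeasurable (hh.comp hτ₂).aestronglyMeasurable
    (hh.comp (hτ₂.comp hτ₁)).aestronglyMeasurable hhM (fun U => hhM _) (fun U => hhM _) (fun U => hhM _)
    iw₀₀ iw₁₀ iw₀₁ iw₁₁ n₀₀ n₁₀ n₀₁ n₁₁ hpos hA hB₁ hB₂ hB₀

end Summit.QuantumFields.YangMills.Theorems.OrganTangentFibreMeanSquareTransport

end
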